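import Mathlib
import HarnessLib
import Summits.Ventures.LatticeQCDFlow.Exactness.OpenBoundaryTranslation
import Summits.Ventures.LatticeQCDFlow.Scoring.FlowedEnergyLatticeSymmetry

/-!
# Open boundary: one-point functions are PROFILES in the open coordinate, and slab–slab second moments reduce to one reference site — exact consequences of the translations orthogonal to the open direction

HONEST FRAMING: exact (Metropolis-corrected) sampling algorithms for lattice gauge theory;
figures of merit are autocorrelation/cost numbers at stated couplings and volumes; no
continuum-physics claim.

Venture `LatticeQCDFlow` (cell pub-lqcd), topic `Exactness`, FANOUT row 21 (`su3-base`, arm `OBC-HMC`: the run check of the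
open-boundary arm is the plaquette / energy PROFILE against the distance from the open boundary, and its topology figure is
built from SLAB charges away from the boundary).  NEW WORK of the cell over row 21's `OpenBoundaryTranslation`
(`obcGibbs_map_configTranslate`: the open-boundary Gibbs law of direction `τ` is invariant under every lattice translation
`T_v` with `v_τ = 0`; `isProbabilityMeasure_obcGibbs`, `integrable_cloverPseudoscalar_obcGibbs`) and
`OpenBoundaryTimeReflection` (`cloverPseudoscalar_configTranslate`, `cloverLeafSum_translate`), row 22's `configTranslate`
/ `plaquetteHolonomy_configTranslate` (`PTBCWilsonDefect`) and the Literature's `flowedCloverEnergy`.  Def-free; nothing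
is cited as a fact; no number.

## What is here (torus `(ℤ/L)^d` carrying the open-boundary weights of direction `τ`; a law `μ` with `μ ∘ T_v⁻¹ = μ` whenever `v_τ = 0`)

A SITE FIELD is `f : Site → Config → E` with `f_x(T_v U) = f_{v+x}(U)`.
* §1 generic: **`integral_siteField_eq_of_apply_eq`** — `E[f_x] = E[f_y]` whenever `x_τ = y_τ`: one-point functions are
  functions of the open coordinate alone (a PROFILE); `integral_siteField_mul_configTranslate` (`E[f_x g_y] =
  E[f_{v+x} g_{v+y}]`, `v_τ = 0`); **`integral_slabSum_mul_slabSum`** — for the slabs `Λ_t = {x : x_τ = t}`,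
  `E[(Σ_{x∈Λ_t} f_x)(Σ_{y∈Λ_{t'}} g_y)] = |Λ_t| · Σ_{y∈Λ_{t'}} E[f_{x₀} g_y]` with the reference site `x₀ = t·e_τ`;
  `integral_slabSum` (`E[Σ_{x∈Λ_t} f_x] = |Λ_t| E[f_{x₀}]`).
* §2 the fields: plaquette functions `φ(U_{x;ij})`, the clover charge density `P_x`, the clover energy density `E_x`
  (`flowedCloverEnergy_zero_configTranslate`, new) are site fields.
* §3 THE OPEN-BOUNDARY GIBBS LAW (any compact `G`, continuous unitary-or-not `ρ`, every `β`, every open direction `τ`):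
  **`obcGibbs_integral_plaquette_eq_of_apply_eq`** (the plaquette one-point function is a profile in `x_τ`, each orientation),
  **`obcGibbs_integral_cloverEnergy_eq_of_apply_eq`** (so is the clover energy density), `obcGibbs_integral_slabCharge_mul_slabCharge`
  (slab-charge second moments `E[Q_t Q_{t'}] = |Λ_t| Σ_{y∈Λ_{t'}} E[P_{x₀} P_y]`, integrability discharged) and
  `obcGibbs_integral_slabEnergy` (`E[Σ_{x∈Λ_t} E_x] = |Λ_t| E[E_{x₀}]`).
* §4 direction `0`, the boundary-exchanging reflection `R = T_{e₀} ∘ Θ'` of `OpenBoundaryTimeReflection`: `plaqRe_configTranslate`,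
  **`flowedCloverEnergy_zero_obcReflect`** (`E_x(RU) = E_{θ'x − e₀}(U)`, with row 21's `flowedCloverEnergy_zero_negReflect`),
  **`obcGibbs_integral_cloverEnergy_obcReflect`** (the energy profile is mirror symmetric, `⟨E_x⟩ = ⟨E_{θ'x−e₀}⟩`: slice `t` and
  slice `−1−t` agree) and **`obcGibbs_integral_plaqRe_obcReflect`** (the plaquette profile: `⟨Re tr ρ(U_p)⟩ =
  ⟨Re tr ρ(U_{ϑ'(e₀+p)})⟩` with the Literature's plaquette involution `sitePlaqReflect`).
NOT CLAIMED: the shape of any profile or its boundary zone; anything flowed with open-boundary flow equations (not typed);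
numbers.
-/

noncomputable section

namespace Summit.Ventures.LatticeQCDFlow.Exactness

open MeasureTheory Set Function
open Literature.MathematicalPhysics.QuantumFieldTheory
open Literature.MathematicalPhysics.QuantumFieldTheory.WilsonSiteRP (sitePlaqReflect negReflectEquiv)
open Literature.MathematicalPhysics.QuantumLattice (cloverPseudoscalar cloverLeafSum flowedClover flowedCloverEnergy
  flowedClover_zero measurable_cloverPseudoscalar exists_abs_cloverPseudoscalar_le continuous_flowedCloverEnergy_zero
  exists_abs_flowedCloverEnergy_zero_le)
open scoped ENNReal

/-! ## §1 Site fields under a law invariant under the translations orthogonal to `τ` -/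

section Generic

variable {d L : ℕ} {G : Type*} [MeasurableSpace G] {τ : Fin d}
variable {μ : Measure (GaugeConfig d L G)} (hμ : ∀ v : Site d L, v τ = 0 → μ.map (configTranslate v) = μ)

include hμ

/-- Invariance as an integral identity: `∫ F(T_v U) dμ = ∫ F dμ` for `v_τ = 0`. -/
theorem integral_comp_configTranslate_of_invariant {v : Site d L} (hv : v τ = 0) {E : Type*} [NormedAddCommGroup E]
    [NormedSpace ℝ E] (F : GaugeConfig d L G → E) :
    ∫ U, F (configTranslate v U) ∂μ = ∫ U, F U ∂μ :=
  (MeasurePreserving.mk (configTranslate v).measurable (hμ v hv)).integral_comp' F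

/-- **ONE-POINT FUNCTIONS ARE PROFILES IN THE OPEN COORDINATE**: `E[f_x] = E[f_y]` whenever `x_τ = y_τ`. -/
theorem integral_siteField_eq_of_apply_eq {E : Type*} [NormedAddCommGroup E] [NormedSpace ℝ E]
    (f : Site d L → GaugeConfig d L G → E) (hf : ∀ v x U, f x (configTranslate v U) = f (v + x) U) {x y : Site d L}
    (hxy : x τ = y τ) : ∫ U, f x U ∂μ = ∫ U, f y U ∂μ := by
  have hv : (y - x) τ = 0 := by rw [Pi.sub_apply, hxy, sub_self]
  have h := integral_comp_configTranslate_of_invariant hμ hv (f x)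
  simp only [hf, sub_add_cancel] at h
  exact h.symm

/-- `E[f_x · g_y] = E[f_{v+x} · g_{v+y}]` for every `v` with `v_τ = 0`. -/
theorem integral_siteField_mul_configTranslate (f g : Site d L → GaugeConfig d L G → ℝ)
    (hf : ∀ v x U, f x (configTranslate v U) = f (v + x) U) (hg : ∀ v x U, g x (configTranslate v U) = g (v + x) U)
    {v : Site d L} (hv : v τ = 0) (x y : Site d L) :
    ∫ U, f x U * g y U ∂μ = ∫ U, f (v + x) U * g (v + y) U ∂μ := by
  have h := integral_comp_configTranslate_of_invariant hμ hv (fun U => f x U * g y U)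
  simp only [hf, hg] at h
  exact h.symm

variable [NeZero L]

omit hμ in
/-- Translating by `v` with `v_τ = 0` permutes each slab `Λ_t = {y : y_τ = t}`. -/
theorem mem_slab_iff_add_mem_slab {v : Site d L} (hv : v τ = 0) (t : ZMod L) (y : Site d L) :
    y ∈ (Finset.univ.filter fun z : Site d L => z τ = t) ↔ v + y ∈ (Finset.univ.filter fun z : Site d L => z τ = t) := by
  simp only [Finset.mem_filter, Finset.mem_univ, true_and, Pi.add_apply, hv, zero_add]

/-- **SLAB–SLAB SECOND MOMENTS REDUCE TO ONE REFERENCE SITE**: with `Λ_t = {x : x_τ = t}` and `x₀ = t·e_τ`,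
`E[(Σ_{x∈Λ_t} f_x)(Σ_{y∈Λ_{t'}} g_y)] = |Λ_t| · Σ_{y∈Λ_{t'}} E[f_{x₀} g_y]` (all products integrable). -/
theorem integral_slabSum_mul_slabSum (f g : Site d L → GaugeConfig d L G → ℝ)
    (hf : ∀ v x U, f x (configTranslate v U) = f (v + x) U) (hg : ∀ v x U, g x (configTranslate v U) = g (v + x) U)
    (hint : ∀ x y, Integrable (fun U => f x U * g y U) μ) (t t' : ZMod L) :
    ∫ U, (∑ x ∈ Finset.univ.filter (fun z : Site d L => z τ = t), f x U) *
        (∑ y ∈ Finset.univ.filter (fun z : Site d L => z τ = t'), g y U) ∂μ =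
      ((Finset.univ.filter fun z : Site d L => z τ = t).card : ℝ) *
        ∑ y ∈ Finset.univ.filter (fun z : Site d L => z τ = t'), ∫ U, f (Pi.single τ t) U * g y U ∂μ := by
  have hexp : ∀ U : GaugeConfig d L G,
      (∑ x ∈ Finset.univ.filter (fun z : Site d L => z τ = t), f x U) *
          (∑ y ∈ Finset.univ.filter (fun z : Site d L => z τ = t'), g y U) =
        ∑ x ∈ Finset.univ.filter (fun z : Site d L => z τ = t), ∑ y ∈ Finset.univ.filter (fun z : Site d L => z τ = t'),
          f x U * g y U :=
    fun U => by rw [Finset.sum_mul_sum]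
  simp only [hexp]
  rw [integral_finsetSum _ fun x _ => integrable_finsetSum _ fun y _ => hint x y]
  have hin : ∀ x ∈ Finset.univ.filter (fun z : Site d L => z τ = t),
      ∫ U, ∑ y ∈ Finset.univ.filter (fun z : Site d L => z τ = t'), f x U * g y U ∂μ =
        ∑ y ∈ Finset.univ.filter (fun z : Site d L => z τ = t'), ∫ U, f (Pi.single τ t) U * g y U ∂μ := by
    intro x hx
    have hxτ : x τ = t := by simpa using hx
    -- translate by `v = x₀ − x`, which has `v_τ = 0`
    have hv : (Pi.single τ t - x : Site d L) τ = 0 := by rw [Pi.sub_apply, Pi.single_eq_same, hxτ, sub_self]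
    rw [integral_finsetSum _ fun y _ => hint x y]
    simp only [integral_siteField_mul_configTranslate hμ f g hf hg hv x, sub_add_cancel]
    refine Finset.sum_equiv (Equiv.addLeft (Pi.single τ t - x : Site d L)) (fun y => ?_) (fun y _ => rfl)
    rw [Equiv.coe_addLeft]
    exact mem_slab_iff_add_mem_slab hv t' y
  rw [Finset.sum_congr rfl hin, Finset.sum_const, nsmul_eq_mul]

/-- `E[Σ_{x∈Λ_t} f_x] = |Λ_t| · E[f_{x₀}]`. -/
theorem integral_slabSum {E : Type*} [NormedAddCommGroup E] [NormedSpace ℝ E] (f : Site d L → GaugeConfig d L G → E)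
    (hf : ∀ v x U, f x (configTranslate v U) = f (v + x) U) (hint : ∀ x, Integrable (f x) μ) (t : ZMod L) :
    ∫ U, ∑ x ∈ Finset.univ.filter (fun z : Site d L => z τ = t), f x U ∂μ =
      ((Finset.univ.filter fun z : Site d L => z τ = t).card : ℝ) • ∫ U, f (Pi.single τ t) U ∂μ := by
  rw [integral_finsetSum _ fun x _ => hint x]
  have h : ∀ x ∈ Finset.univ.filter (fun z : Site d L => z τ = t), ∫ U, f x U ∂μ = ∫ U, f (Pi.single τ t) U ∂μ := by
    intro x hx
    have hxτ : x τ = t := by simpa using hx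
    exact integral_siteField_eq_of_apply_eq hμ f hf (by rw [hxτ, Pi.single_eq_same])
  rw [Finset.sum_congr rfl h, Finset.sum_const, ← Nat.cast_smul_eq_nsmul ℝ]

end Generic

/-! ## §2 The fields: plaquette functions, the clover charge density and the clover energy density -/

section Fields

variable {d L N : ℕ} {G : Type*} [Group G] [MeasurableSpace G] (ρ : G →* Matrix (Fin N) (Fin N) ℂ)

omit [MeasurableSpace G] in
/-- A function of one plaquette holonomy is a site field (each orientation). -/
theorem plaquetteField_configTranslate [MeasurableSpace G] {E : Type*} (φ : G → E) (i j : Fin d) (v x : Site d L)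
    (U : GaugeConfig d L G) :
    φ (plaquetteHolonomy (configTranslate v U) x i j) = φ (plaquetteHolonomy U (v + x) i j) := by
  rw [plaquetteHolonomy_configTranslate]

/-- **`E_x(T_v U) = E_{v+x}(U)`**: the bare clover energy density is a site field (any `d`). -/
theorem flowedCloverEnergy_zero_configTranslate (v x : Site d L) (U : GaugeConfig d L G) :
    flowedCloverEnergy ρ 0 x (configTranslate v U) = flowedCloverEnergy ρ 0 (v + x) U := by
  have hV : (fun e : Edge d L => ρ (configTranslate v U e)) = fun e => (fun e' : Edge d L => ρ (U e')) (v + e.1, e.2) :=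
    funext fun e => by rw [configTranslate_apply_edge]
  have hC : ∀ μ ν, flowedClover ρ 0 (configTranslate v U) x μ ν = flowedClover ρ 0 U (v + x) μ ν := fun μ ν => by
    rw [flowedClover_zero, flowedClover_zero, hV]
    exact congrArg (fun M => Literature.MathematicalPhysics.QuantumLattice.lieProjection (Set.range ρ) ((1 / 4 : ℝ) • M))
      (cloverLeafSum_translate (fun e => ρ (U e)) v x μ ν)
  simp only [flowedCloverEnergy, hC]

end Fields

/-! ## §3 The open-boundary Gibbs law: profiles and slab second moments -/

section OBC

variable {d L N : ℕ} [NeZero L] {G : Type*} [Group G] [MeasurableSpace G] [TopologicalSpace G] [IsTopologicalGroup G]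
  [CompactSpace G] [BorelSpace G] (ρ : G →* Matrix (Fin N) (Fin N) ℂ) (τ : Fin d) (β : ℝ)

/-- **THE PLAQUETTE ONE-POINT FUNCTION IS A PROFILE IN THE OPEN COORDINATE**: under the open-boundary Gibbs law of
direction `τ`, `⟨φ(U_{x;ij})⟩ = ⟨φ(U_{y;ij})⟩` whenever `x_τ = y_τ`, for every function `φ` of one holonomy and every
orientation `(i, j)`. -/
theorem obcGibbs_integral_plaquette_eq_of_apply_eq {E : Type*} [NormedAddCommGroup E] [NormedSpace ℝ E] (φ : G → E)
    (i j : Fin d) {x y : Site d L} (hxy : x τ = y τ) :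
    ∫ U, φ (plaquetteHolonomy U x i j) ∂(gibbsProbability (Measure.pi fun _ : Edge d L => haarProbability G)
        (fun U => Real.exp (-(β * obcAction ρ τ U)))) =
      ∫ U, φ (plaquetteHolonomy U y i j) ∂(gibbsProbability (Measure.pi fun _ : Edge d L => haarProbability G)
        (fun U => Real.exp (-(β * obcAction ρ τ U)))) :=
  integral_siteField_eq_of_apply_eq (fun _ hv => obcGibbs_map_configTranslate ρ hv β)
    (fun x U => φ (plaquetteHolonomy U x i j)) (fun v x U => plaquetteField_configTranslate φ i j v x U) hxy

/-- **THE CLOVER ENERGY DENSITY IS A PROFILE IN THE OPEN COORDINATE**: `⟨E_x⟩_OBC = ⟨E_y⟩_OBC` whenever `x_τ = y_τ`. -/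
theorem obcGibbs_integral_cloverEnergy_eq_of_apply_eq {x y : Site d L} (hxy : x τ = y τ) :
    ∫ U, flowedCloverEnergy ρ 0 x U ∂(gibbsProbability (Measure.pi fun _ : Edge d L => haarProbability G)
        (fun U => Real.exp (-(β * obcAction ρ τ U)))) =
      ∫ U, flowedCloverEnergy ρ 0 y U ∂(gibbsProbability (Measure.pi fun _ : Edge d L => haarProbability G)
        (fun U => Real.exp (-(β * obcAction ρ τ U)))) :=
  integral_siteField_eq_of_apply_eq (fun _ hv => obcGibbs_map_configTranslate ρ hv β)
    (fun x U => flowedCloverEnergy ρ 0 x U) (fun v x U => flowedCloverEnergy_zero_configTranslate ρ v x U) hxy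

/-- The clover charge density one-point function is a profile too (and in fact vanishes, `OpenBoundaryTranslation` /
`OpenBoundaryChargeDensity`); recorded for the two-point reduction below. -/
theorem obcGibbs_integral_cloverPseudoscalar_eq_of_apply_eq {τ : Fin 4} {x y : Site 4 L} (hxy : x τ = y τ) :
    ∫ U, cloverPseudoscalar ρ x U ∂(gibbsProbability (Measure.pi fun _ : Edge 4 L => haarProbability G)
        (fun U => Real.exp (-(β * obcAction ρ τ U)))) =
      ∫ U, cloverPseudoscalar ρ y U ∂(gibbsProbability (Measure.pi fun _ : Edge 4 L => haarProbability G)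
        (fun U => Real.exp (-(β * obcAction ρ τ U)))) :=
  integral_siteField_eq_of_apply_eq (fun _ hv => obcGibbs_map_configTranslate ρ hv β)
    (fun x U => cloverPseudoscalar ρ x U) (fun v x U => cloverPseudoscalar_configTranslate ρ v x U) hxy

variable [SecondCountableTopology G]

/-- **SLAB-CHARGE SECOND MOMENTS**: for the slab charges `Q_t = Σ_{x : x_τ = t} P_x` of the open lattice,
`⟨Q_t Q_{t'}⟩_OBC = |Λ_t| · Σ_{y : y_τ = t'} ⟨P_{t e_τ} P_y⟩_OBC` — the estimator of the slab-based topology figure is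
`|Λ_t|` times the summed two-point function of the density from one reference site, exactly (continuous `ρ`; no other
hypothesis). -/
theorem obcGibbs_integral_slabCharge_mul_slabCharge (hρ : Continuous ρ) (τ : Fin 4) (t t' : ZMod L) :
    ∫ U, (∑ x ∈ Finset.univ.filter (fun z : Site 4 L => z τ = t), cloverPseudoscalar ρ x U) *
        (∑ y ∈ Finset.univ.filter (fun z : Site 4 L => z τ = t'), cloverPseudoscalar ρ y U)
        ∂(gibbsProbability (Measure.pi fun _ : Edge 4 L => haarProbability G) (fun U => Real.exp (-(β * obcAction ρ τ U)))) =
      ((Finset.univ.filter fun z : Site 4 L => z τ = t).card : ℝ) *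
        ∑ y ∈ Finset.univ.filter (fun z : Site 4 L => z τ = t'),
          ∫ U, cloverPseudoscalar ρ (Pi.single τ t) U * cloverPseudoscalar ρ y U
            ∂(gibbsProbability (Measure.pi fun _ : Edge 4 L => haarProbability G)
              (fun U => Real.exp (-(β * obcAction ρ τ U)))) := by
  haveI := isProbabilityMeasure_obcGibbs (d := 4) (L := L) ρ hρ τ β
  have hint : ∀ x y : Site 4 L, Integrable (fun U : GaugeConfig 4 L G => cloverPseudoscalar ρ x U * cloverPseudoscalar ρ y U)
      (gibbsProbability (Measure.pi fun _ : Edge 4 L => haarProbability G) (fun U => Real.exp (-(β * obcAction ρ τ U)))) := by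
    intro x y
    obtain ⟨C, hC⟩ := exists_abs_cloverPseudoscalar_le ρ hρ x
    obtain ⟨C', hC'⟩ := exists_abs_cloverPseudoscalar_le ρ hρ y
    refine Integrable.mono' (integrable_const (C * C'))
      ((measurable_cloverPseudoscalar ρ hρ x).mul (measurable_cloverPseudoscalar ρ hρ y)).aestronglyMeasurable
      (ae_of_all _ fun U => ?_)
    rw [Real.norm_eq_abs, abs_mul]
    exact mul_le_mul (hC U) (hC' U) (abs_nonneg _) ((abs_nonneg _).trans (hC U))
  exact integral_slabSum_mul_slabSum (fun _ hv => obcGibbs_map_configTranslate ρ hv β) _ _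
    (fun v x U => cloverPseudoscalar_configTranslate ρ v x U) (fun v x U => cloverPseudoscalar_configTranslate ρ v x U) hint t t'

/-- **`⟨Σ_{x : x_τ = t} E_x⟩_OBC = |Λ_t| · ⟨E_{t e_τ}⟩_OBC`**: the slab-summed energy profile is the slab size times the density
profile (continuous `ρ`). -/
theorem obcGibbs_integral_slabEnergy (hρ : Continuous ρ) (t : ZMod L) :
    ∫ U, ∑ x ∈ Finset.univ.filter (fun z : Site d L => z τ = t), flowedCloverEnergy ρ 0 x U
        ∂(gibbsProbability (Measure.pi fun _ : Edge d L => haarProbability G) (fun U => Real.exp (-(β * obcAction ρ τ U)))) =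
      ((Finset.univ.filter fun z : Site d L => z τ = t).card : ℝ) •
        ∫ U, flowedCloverEnergy ρ 0 (Pi.single τ t) U
          ∂(gibbsProbability (Measure.pi fun _ : Edge d L => haarProbability G) (fun U => Real.exp (-(β * obcAction ρ τ U)))) := by
  haveI := isProbabilityMeasure_obcGibbs (d := d) (L := L) ρ hρ τ β
  have hint : ∀ x : Site d L, Integrable (fun U : GaugeConfig d L G => flowedCloverEnergy ρ 0 x U)
      (gibbsProbability (Measure.pi fun _ : Edge d L => haarProbability G) (fun U => Real.exp (-(β * obcAction ρ τ U)))) := by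
    intro x
    obtain ⟨C, hC⟩ := exists_abs_flowedCloverEnergy_zero_le ρ hρ x
    exact Integrable.mono' (integrable_const C) (continuous_flowedCloverEnergy_zero ρ hρ x).measurable.aestronglyMeasurable
      (ae_of_all _ fun U => by rw [Real.norm_eq_abs]; exact hC U)
  exact integral_slabSum (fun _ hv => obcGibbs_map_configTranslate ρ hv β) _
    (fun v x U => flowedCloverEnergy_zero_configTranslate ρ v x U) hint t

end OBC

/-! ## §4 Direction `0`: the profiles are mirror symmetric under the boundary-exchanging reflection -/

section Reflect

variable {d L N : ℕ} {G : Type*} [Group G] [MeasurableSpace G] (ρ : G →* Matrix (Fin N) (Fin N) ℂ)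

/-- `Re tr ρ((T_v U)_p) = Re tr ρ(U_{v + p})`. -/
theorem plaqRe_configTranslate (v : Site d L) (U : GaugeConfig d L G) (p : Plaquette d L) :
    WilsonRP.plaqRe ρ (configTranslate v U) p = WilsonRP.plaqRe ρ U (v + p.1, p.2) := by
  simp only [WilsonRP.plaqRe, plaquetteHolonomy_configTranslate]

/-- **`E_x(R U) = E_{θ'x − e₀}(U)`** for `R = T_{e₀} ∘ Θ'` (unitary `ρ`): the clover energy density is EVEN under the open
lattice's time reflection (the charge density is odd, `cloverPseudoscalar_obcReflect`). -/
theorem flowedCloverEnergy_zero_obcReflect [NeZero d] (hρu : ∀ g, ρ g ∈ Matrix.unitaryGroup (Fin N) ℂ) (x : Site d L)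
    (U : GaugeConfig d L G) :
    flowedCloverEnergy ρ 0 x (configTranslate (Pi.single 0 1) U.negReflect) =
      flowedCloverEnergy ρ 0 (x.negReflect - Pi.single 0 1) U := by
  rw [flowedCloverEnergy_zero_configTranslate, Scoring.flowedCloverEnergy_zero_negReflect ρ hρu, add_comm,
    Scoring.negReflect_add_single_zero]

variable [NeZero d] [NeZero L] [TopologicalSpace G] [IsTopologicalGroup G] [CompactSpace G] [BorelSpace G] (β : ℝ)

/-- **THE ENERGY PROFILE IS MIRROR SYMMETRIC** (open direction `0`): `⟨E_x⟩_OBC = ⟨E_{θ'x − e₀}⟩_OBC` — with §3, the slice-`t`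
and slice-`(−1−t)` values of the profile agree (continuous unitary `ρ`, every `β`). -/
theorem obcGibbs_integral_cloverEnergy_obcReflect (hρ : Continuous ρ) (hρu : ∀ g, ρ g ∈ Matrix.unitaryGroup (Fin N) ℂ)
    (x : Site d L) :
    ∫ U, flowedCloverEnergy ρ 0 (x.negReflect - Pi.single 0 1) U ∂(gibbsProbability (Measure.pi fun _ : Edge d L => haarProbability G)
        (fun U => Real.exp (-(β * obcAction ρ 0 U)))) =
      ∫ U, flowedCloverEnergy ρ 0 x U ∂(gibbsProbability (Measure.pi fun _ : Edge d L => haarProbability G)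
        (fun U => Real.exp (-(β * obcAction ρ 0 U)))) := by
  have h : ∫ U : GaugeConfig d L G, flowedCloverEnergy ρ 0 x (configTranslate (Pi.single 0 1) U.negReflect)
        ∂(gibbsProbability (Measure.pi fun _ : Edge d L => haarProbability G) (fun U => Real.exp (-(β * obcAction ρ 0 U)))) =
      ∫ U, flowedCloverEnergy ρ 0 x U
        ∂(gibbsProbability (Measure.pi fun _ : Edge d L => haarProbability G) (fun U => Real.exp (-(β * obcAction ρ 0 U)))) :=
    (measurePreserving_obcReflect_obcGibbs (d := d) (L := L) ρ hρ β).integral_comp' (g := fun U => flowedCloverEnergy ρ 0 x U)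
  simp only [flowedCloverEnergy_zero_obcReflect ρ hρu] at h
  exact h

/-- **THE PLAQUETTE PROFILE IS MIRROR SYMMETRIC** (open direction `0`): `⟨Re tr ρ(U_p)⟩_OBC = ⟨Re tr ρ(U_{ϑ'(e₀ + p)})⟩_OBC` with the
Literature's plaquette involution `ϑ' = sitePlaqReflect` of `Θ'` (a spatial plaquette based at slice `t` goes to one based at
slice `−1−t`; continuous `ρ`, every `β`). -/
theorem obcGibbs_integral_plaqRe_obcReflect (hρ : Continuous ρ) (p : Plaquette d L) :
    ∫ U, WilsonRP.plaqRe ρ U (sitePlaqReflect ((Pi.single 0 1 : Site d L) + p.1, p.2))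
        ∂(gibbsProbability (Measure.pi fun _ : Edge d L => haarProbability G) (fun U => Real.exp (-(β * obcAction ρ 0 U)))) =
      ∫ U, WilsonRP.plaqRe ρ U p
        ∂(gibbsProbability (Measure.pi fun _ : Edge d L => haarProbability G) (fun U => Real.exp (-(β * obcAction ρ 0 U)))) := by
  have h : ∫ U : GaugeConfig d L G, WilsonRP.plaqRe ρ (configTranslate (Pi.single 0 1) U.negReflect) p
        ∂(gibbsProbability (Measure.pi fun _ : Edge d L => haarProbability G) (fun U => Real.exp (-(β * obcAction ρ 0 U)))) =
      ∫ U, WilsonRP.plaqRe ρ U p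
        ∂(gibbsProbability (Measure.pi fun _ : Edge d L => haarProbability G) (fun U => Real.exp (-(β * obcAction ρ 0 U)))) :=
    (measurePreserving_obcReflect_obcGibbs (d := d) (L := L) ρ hρ β).integral_comp' (g := fun U => WilsonRP.plaqRe ρ U p)
  simp only [plaqRe_configTranslate, WilsonSiteRP.plaqRe_negReflect ρ hρ] at h
  exact h

end Reflect

end Summit.Ventures.LatticeQCDFlow.Exactness

/-! ## §5 (appended) Direction `0`: two-point functions and slab-charge correlators are mirror symmetric

Appended by the same seat (GEN-6 of row 21): the second-moment twins of §4.  Under the open-boundary Gibbs law of direction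
`0`, `R = T_{e₀} ∘ Θ'` preserves the law, so `E[F(RU) G(RU)] = E[F G]`; the energy density goes to itself at the mirrored site,
the charge density to MINUS itself, and `x ↦ θ'x − e₀` carries the slab `{x₀ = t}` onto `{x₀ = −1 − t}`; hence the energy two-point
function and the SLAB-CHARGE CORRELATOR are mirror symmetric: `E[Q_t Q_{t'}] = E[Q_{−1−t} Q_{−1−t'}]` (the two signs cancel).
-/

namespace Summit.Ventures.LatticeQCDFlow.Exactness

open MeasureTheory Set Function
open Literature.MathematicalPhysics.QuantumFieldTheory
open Literature.MathematicalPhysics.QuantumLattice (cloverPseudoscalar flowedCloverEnergy)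

section ReflectTwoPoint

variable {d L N : ℕ} [NeZero d] [NeZero L] {G : Type*} [Group G] [MeasurableSpace G] [TopologicalSpace G]
  [IsTopologicalGroup G] [CompactSpace G] [BorelSpace G] (ρ : G →* Matrix (Fin N) (Fin N) ℂ) (β : ℝ)

/-- **`E[F(RU) · G(RU)] = E[F · G]`** under the open-boundary Gibbs law of direction `0`, for all real observables. -/
theorem obcGibbs_integral_mul_obcReflect (hρ : Continuous ρ) (F F' : GaugeConfig d L G → ℝ) :
    ∫ U : GaugeConfig d L G, F (configTranslate (Pi.single 0 1) U.negReflect) * F' (configTranslate (Pi.single 0 1) U.negReflect)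
        ∂(gibbsProbability (Measure.pi fun _ : Edge d L => haarProbability G) (fun U => Real.exp (-(β * obcAction ρ 0 U)))) =
      ∫ U, F U * F' U ∂(gibbsProbability (Measure.pi fun _ : Edge d L => haarProbability G)
        (fun U => Real.exp (-(β * obcAction ρ 0 U)))) :=
  (measurePreserving_obcReflect_obcGibbs (d := d) (L := L) ρ hρ β).integral_comp' (g := fun U => F U * F' U)

/-- **THE ENERGY TWO-POINT FUNCTION IS MIRROR SYMMETRIC**: `⟨E_{θ'x−e₀} E_{θ'y−e₀}⟩_OBC = ⟨E_x E_y⟩_OBC` (open direction `0`;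
continuous unitary `ρ`). -/
theorem obcGibbs_integral_cloverEnergy_mul_obcReflect (hρ : Continuous ρ) (hρu : ∀ g, ρ g ∈ Matrix.unitaryGroup (Fin N) ℂ)
    (x y : Site d L) :
    ∫ U, flowedCloverEnergy ρ 0 (x.negReflect - Pi.single 0 1) U * flowedCloverEnergy ρ 0 (y.negReflect - Pi.single 0 1) U
        ∂(gibbsProbability (Measure.pi fun _ : Edge d L => haarProbability G) (fun U => Real.exp (-(β * obcAction ρ 0 U)))) =
      ∫ U, flowedCloverEnergy ρ 0 x U * flowedCloverEnergy ρ 0 y U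
        ∂(gibbsProbability (Measure.pi fun _ : Edge d L => haarProbability G) (fun U => Real.exp (-(β * obcAction ρ 0 U)))) := by
  have h := obcGibbs_integral_mul_obcReflect ρ β hρ (fun U => flowedCloverEnergy ρ 0 x U) (fun U => flowedCloverEnergy ρ 0 y U)
  simp only [flowedCloverEnergy_zero_obcReflect ρ hρu] at h
  exact h

end ReflectTwoPoint

section SlabCorrelator

variable {L N : ℕ} [NeZero L] {G : Type*} [Group G] [MeasurableSpace G] (ρ : G →* Matrix (Fin N) (Fin N) ℂ)

/-- The site map `x ↦ θ'x − e₀` carries the slab `{x₀ = t}` onto the slab `{x₀ = −1 − t}`. -/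
theorem mem_slab_zero_iff_obcReflectSite_mem (t : ZMod L) (x : Site 4 L) :
    x ∈ (Finset.univ.filter fun z : Site 4 L => z 0 = t) ↔
      x.negReflect - Pi.single 0 1 ∈ (Finset.univ.filter fun z : Site 4 L => z 0 = -1 - t) := by
  simp only [Finset.mem_filter, Finset.mem_univ, true_and, Pi.sub_apply, WilsonSiteRP.negReflect_apply_zero, Pi.single_eq_same]
  constructor
  · intro h; rw [h]; ring
  · intro h; linear_combination -h

/-- **`Q_t(R U) = −Q_{−1−t}(U)`**: the slab charge of the reflected configuration is minus the charge of the mirrored slab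
(unitary `ρ`). -/
theorem slabCharge_obcReflect (hρu : ∀ g, ρ g ∈ Matrix.unitaryGroup (Fin N) ℂ) (t : ZMod L) (U : GaugeConfig 4 L G) :
    ∑ x ∈ Finset.univ.filter (fun z : Site 4 L => z 0 = t), cloverPseudoscalar ρ x (configTranslate (Pi.single 0 1) U.negReflect) =
      -∑ x ∈ Finset.univ.filter (fun z : Site 4 L => z 0 = -1 - t), cloverPseudoscalar ρ x U := by
  rw [Finset.sum_congr rfl fun x _ => cloverPseudoscalar_obcReflect ρ hρu x U, Finset.sum_neg_distrib]
  exact congrArg Neg.neg (Finset.sum_equiv (obcReflectSite_involutive (L := L)).toPerm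
    (fun x => mem_slab_zero_iff_obcReflectSite_mem t x) fun x _ => rfl)

variable [TopologicalSpace G] [IsTopologicalGroup G] [CompactSpace G] [BorelSpace G] (β : ℝ)

/-- **THE SLAB-CHARGE CORRELATOR IS MIRROR SYMMETRIC**: `⟨Q_{−1−t} Q_{−1−t'}⟩_OBC = ⟨Q_t Q_{t'}⟩_OBC` for all slices `t, t'`
(open direction `0`; continuous unitary `ρ`; the two reflection signs cancel). -/
theorem obcGibbs_integral_slabCharge_mul_obcReflect (hρ : Continuous ρ) (hρu : ∀ g, ρ g ∈ Matrix.unitaryGroup (Fin N) ℂ)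
    (t t' : ZMod L) :
    ∫ U, (∑ x ∈ Finset.univ.filter (fun z : Site 4 L => z 0 = -1 - t), cloverPseudoscalar ρ x U) *
        (∑ y ∈ Finset.univ.filter (fun z : Site 4 L => z 0 = -1 - t'), cloverPseudoscalar ρ y U)
        ∂(gibbsProbability (Measure.pi fun _ : Edge 4 L => haarProbability G) (fun U => Real.exp (-(β * obcAction ρ 0 U)))) =
      ∫ U, (∑ x ∈ Finset.univ.filter (fun z : Site 4 L => z 0 = t), cloverPseudoscalar ρ x U) *
        (∑ y ∈ Finset.univ.filter (fun z : Site 4 L => z 0 = t'), cloverPseudoscalar ρ y U)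
        ∂(gibbsProbability (Measure.pi fun _ : Edge 4 L => haarProbability G) (fun U => Real.exp (-(β * obcAction ρ 0 U)))) := by
  have h := obcGibbs_integral_mul_obcReflect ρ β hρ
    (fun U => ∑ x ∈ Finset.univ.filter (fun z : Site 4 L => z 0 = t), cloverPseudoscalar ρ x U)
    (fun U => ∑ y ∈ Finset.univ.filter (fun z : Site 4 L => z 0 = t'), cloverPseudoscalar ρ y U)
  simp only [slabCharge_obcReflect ρ hρu, neg_mul_neg] at h
  exact h

end SlabCorrelator

end Summit.Ventures.LatticeQCDFlow.Exactness
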